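import Mathlib
import HarnessLib
import Summits.SmoothPoincare4.SmoothPoincare4.Theses.RootDecompC
import Summits.SmoothPoincare4.SmoothPoincare4.Theses.ThreeFibres
import Literature.Topology.FourManifolds.SphereFamilySurgery

/-!
# LINE «killer_shape» (decomp-sp4 lens-3 gen 12; vehicle B′) under the layer-2 crux
C.StableMirrorCancellation = stmt-SmoothPoincare4-28014 (route-SmoothPoincare4-RootDecompC rev 2; tree file imported BY NAME, unchanged).

  MCS #28014 ⟸ [#13903 `ThreeFibres.SurgeryDictionary` BY NAME, binder]
             ∧ stub_twinSeparation   [E-column · byte-identical statement to line «twin_separation»'s stub (COUNT ONCE)]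
             ∧ stub_transport        [dictionary support · COSTUME(cite GompfStipsicz1999 §5.2): orbit form ⟹ an AS-GIVEN off-fibre re-presentation]
             ∧ stub_dualOnceOff      [RUNG · WEAKER · ATTACKABLE: Gabai light-bulb theorem (Gabai2020 Thm 1.2) — the meridional-killer rows]
             ∧ stub_nonDualKiller    [LOAD-BEARING · species R · = SATL (knot-and-killer surgery) minus the dual-once rows; by the
                                      certified shape verdict `KillerShape.nonDual_iff_offFibreLit` it is SATL in costume (pillbox move),
                                      so its honest content is exactly SATL's: undecided specimens = non-meridional killers (SWW 2010);
                                      instrument T-KILLER / T-KILLER-AK / T-KILLER-R]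
Composition `StableMirrorCancellation_of` is sorry-free (W1 form: foreign item as binder, local stubs by name, all USED);
sorries = the 4 stubs. Kernel record: HOME/decomp-sp4-lens-3/v12/KillerShapeV12.lean (`stableMirrorCancellation28014_of_cells`).
Relation to line B «twin_separation» (writer package g4/twinlines): B′ = B with stub_offFibre split as
stub_offFibre ⟸ stub_transport ∧ stub_dualOnceOff ∧ stub_nonDualKiller (kernel `offFibre_of_offFibreLit` ∘ `offFibreLit_of_cells`);
B stays primary; B′ exposes the LBT rung as a separately closable stub.
-/

open scoped Manifold ContDiff

set_option linter.dupNamespace false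

namespace Summit.SmoothPoincare4.SmoothPoincare4.Cruxes.StableMirrorCancellation.KillerShape

open Summit.SmoothPoincare4.SmoothPoincare4.Theses

/-- stub · E-column (twin separation; = line «twin_separation» stub_twinSeparation verbatim; species E, pooled, COUNT ONCE). -/
theorem stub_twinSeparation : open scoped ContDiff in ∀ ν : Literature.Topology.FourManifolds.FramedSphereFamily ((𝓡 2).prod (𝓡 2)) ((Metric.sphere (0 : EuclideanSpace ℝ (Fin 3)) 1) × (Metric.sphere (0 : EuclideanSpace ℝ (Fin 3)) 1)) (Fin 1) 2 2, Manifold.IsSmoothEmbedding (𝓡 2) ((𝓡 2).prod (𝓡 2)) ∞ (ν.sphere 0) → (∃ (x : Metric.sphere (0 : EuclideanSpace ℝ (Fin 3)) 1) (F G : C(Metric.sphere (0 : EuclideanSpace ℝ (Fin 3)) 1, (Metric.sphere (0 : EuclideanSpace ℝ (Fin 3)) 1) × (Metric.sphere (0 : EuclideanSpace ℝ (Fin 3)) 1))), ⇑F = ν.sphere 0 ∧ ⇑G = (fun p => (x, p)) ∧ F.Homotopic G) → SimplyConnectedSpace ↥(Set.range (ν.sphere 0))ᶜ → (∃ (ψ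 : ((Metric.sphere (0 : EuclideanSpace ℝ (Fin 3)) 1) × (Metric.sphere (0 : EuclideanSpace ℝ (Fin 3)) 1)) ≃ₘ⟮(𝓡 2).prod (𝓡 2), (𝓡 2).prod (𝓡 2)⟯ ((Metric.sphere (0 : EuclideanSpace ℝ (Fin 3)) 1) × (Metric.sphere (0 : EuclideanSpace ℝ (Fin 3)) 1))) (x' : Metric.sphere (0 : EuclideanSpace ℝ (Fin 3)) 1), ∀ p, (ψ (ν.sphere 0 p)).1 ≠ x') := by
  sorry

/-- stub · dictionary support · COSTUME(cite): presentation transport (orbit form ⟹ as-given off-fibre re-presentation of the same `M`). -/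
theorem stub_transport : open scoped ContDiff in ∀ (M : Type) [TopologicalSpace M] [T2Space M] [SecondCountableTopology M] [ChartedSpace (EuclideanSpace ℝ (Fin 4)) M] [IsManifold (𝓡 4) ∞ M], ContinuousMap.HomotopyEquiv M (Metric.sphere (0 : EuclideanSpace ℝ (Fin 5)) 1) → ∀ ν : Literature.Topology.FourManifolds.FramedSphereFamily ((𝓡 2).prod (𝓡 2)) ((Metric.sphere (0 : EuclideanSpace ℝ (Fin 3)) 1) × (Metric.sphere (0 : EuclideanSpace ℝ (Fin 3)) 1)) (Fin 1) 2 2, Manifold.IsSmoothEmbedding (𝓡 2) ((𝓡 2).prod (𝓡 2)) ∞ (ν.sphere 0) → (∃ (x : Metric.sphere (0 : EuclideanSpace ℝ (Fin 3)) 1) (F G : C(Metric.sphere (0 : EuclideanSpace ℝ (Fin 3)) 1, (Metric.sphere (0 : EuclideanSpace ℝ (Fin 3)) 1) × (Metric.sphere (0 : EuclideanSpace ℝ (Fin 3)) 1))), ⇑F = ν.sphere 0 ∧ ⇑G = (fun p => (x, p)) ∧ F.Homotopic G) → SimplyConnectedSpace ↥(Set.range (ν.sphere 0))ᶜ → ν.IsSurgery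 (𝓡 4) M → (∃ (ψ : ((Metric.sphere (0 : EuclideanSpace ℝ (Fin 3)) 1) × (Metric.sphere (0 : EuclideanSpace ℝ (Fin 3)) 1)) ≃ₘ⟮(𝓡 2).prod (𝓡 2), (𝓡 2).prod (𝓡 2)⟯ ((Metric.sphere (0 : EuclideanSpace ℝ (Fin 3)) 1) × (Metric.sphere (0 : EuclideanSpace ℝ (Fin 3)) 1))) (x' : Metric.sphere (0 : EuclideanSpace ℝ (Fin 3)) 1), ∀ p, (ψ (ν.sphere 0 p)).1 ≠ x') → ∃ ν' : Literature.Topology.FourManifolds.FramedSphereFamily ((𝓡 2).prod (𝓡 2)) ((Metric.sphere (0 : EuclideanSpace ℝ (Fin 3)) 1) × (Metric.sphere (0 : EuclideanSpace ℝ (Fin 3)) 1)) (Fin 1) 2 2, Manifold.IsSmoothEmbedding (𝓡 2) ((𝓡 2).prod (𝓡 2)) ∞ (ν'.sphere 0) ∧ (∃ (x : Metric.sphere (0 : EuclideanSpace ℝ (Fin 3)) 1) (F G : C(Metric.sphere (0 : EuclideanSpace ℝ (Fin 3)) 1, (Metric.sphere (0 : EuclideanSpace ℝ (Fin 3)) 1)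 × (Metric.sphere (0 : EuclideanSpace ℝ (Fin 3)) 1))), ⇑F = ν'.sphere 0 ∧ ⇑G = (fun p => (x, p)) ∧ F.Homotopic G) ∧ SimplyConnectedSpace ↥(Set.range (ν'.sphere 0))ᶜ ∧ ν'.IsSurgery (𝓡 4) M ∧ (∃ x' : Metric.sphere (0 : EuclideanSpace ℝ (Fin 3)) 1, ∀ p, (ν'.sphere 0 p).1 ≠ x') := by
  sorry

/-- stub · RUNG · WEAKER · ATTACKABLE (Gabai LBT): dual-once ∣ off-fibre cancellation (meridional killers). -/
theorem stub_dualOnceOff : open scoped ContDiff in ∀ (M : Type) [TopologicalSpace M] [T2Space M] [SecondCountableTopology M] [ChartedSpace (EuclideanSpace ℝ (Fin 4)) M] [IsManifold (𝓡 4) ∞ M], ContinuousMap.HomotopyEquiv M (Metric.sphere (0 : EuclideanSpace ℝ (Fin 5)) 1) → ∀ ν : Literature.Topology.FourManifolds.FramedSphereFamily ((𝓡 2).prod (𝓡 2)) ((Metric.sphere (0 : EuclideanSpace ℝ (Fin 3)) 1) × (Metric.sphere (0 : EuclideanSpace ℝ (Fin 3)) 1)) (Fin 1) 2 2, Manifold.IsSmoothEmbedding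 (𝓡 2) ((𝓡 2).prod (𝓡 2)) ∞ (ν.sphere 0) → (∃ (x : Metric.sphere (0 : EuclideanSpace ℝ (Fin 3)) 1) (F G : C(Metric.sphere (0 : EuclideanSpace ℝ (Fin 3)) 1, (Metric.sphere (0 : EuclideanSpace ℝ (Fin 3)) 1) × (Metric.sphere (0 : EuclideanSpace ℝ (Fin 3)) 1))), ⇑F = ν.sphere 0 ∧ ⇑G = (fun p => (x, p)) ∧ F.Homotopic G) → SimplyConnectedSpace ↥(Set.range (ν.sphere 0))ᶜ → ν.IsSurgery (𝓡 4) M → (∃ x' : Metric.sphere (0 : EuclideanSpace ℝ (Fin 3)) 1, ∀ p, (ν.sphere 0 p).1 ≠ x') → (∃ y₀ : Metric.sphere (0 : EuclideanSpace ℝ (Fin 3)) 1, ∃! p : Metric.sphere (0 : EuclideanSpace ℝ (Fin 3)) 1, (ν.sphere 0 p).2 = y₀) → Nonempty (M ≃ₘ⟮𝓡 4, 𝓡 4⟯ Metric.sphere (0 : EuclideanSpace ℝ (Fin 5)) 1) := by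
  sorry

/-- stub · LOAD-BEARING · species R: non-dual killer cancellation AS GIVEN (= SATL in costume by the pillbox move; specimens:
non-meridional killers of 2-knot groups, Silver–Whitten–Williams 2010; first decided-in-print candidates: the Akbulut–Kirby /
Gompf presentation spheres ⟨x,y | xyx=yxy, xⁿ⁺¹=yⁿ⟩ read as killer surgeries on the spun trefoil — census ask T-KILLER-AK). -/
theorem stub_nonDualKiller : open scoped ContDiff in ∀ (M : Type) [TopologicalSpace M] [T2Space M] [SecondCountableTopology M] [ChartedSpace (EuclideanSpace ℝ (Fin 4)) M] [IsManifold (𝓡 4) ∞ M], ContinuousMap.HomotopyEquiv M (Metric.sphere (0 : EuclideanSpace ℝ (Fin 5)) 1) → ∀ ν : Literature.Topology.FourManifolds.FramedSphereFamily ((𝓡 2).prod (𝓡 2)) ((Metric.sphere (0 : EuclideanSpace ℝ (Fin 3)) 1) × (Metric.sphere (0 : EuclideanSpace ℝ (Fin 3)) 1)) (Fin 1) 2 2, Manifold.IsSmoothEmbedding (𝓡 2) ((𝓡 2).prod (𝓡 2)) ∞ (ν.sphere 0) → (∃ (x : Metric.sphere (0 : EuclideanSpace ℝ (Fin 3)) 1)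 (F G : C(Metric.sphere (0 : EuclideanSpace ℝ (Fin 3)) 1, (Metric.sphere (0 : EuclideanSpace ℝ (Fin 3)) 1) × (Metric.sphere (0 : EuclideanSpace ℝ (Fin 3)) 1))), ⇑F = ν.sphere 0 ∧ ⇑G = (fun p => (x, p)) ∧ F.Homotopic G) → SimplyConnectedSpace ↥(Set.range (ν.sphere 0))ᶜ → ν.IsSurgery (𝓡 4) M → (∃ x' : Metric.sphere (0 : EuclideanSpace ℝ (Fin 3)) 1, ∀ p, (ν.sphere 0 p).1 ≠ x') → ¬ (∃ y₀ : Metric.sphere (0 : EuclideanSpace ℝ (Fin 3)) 1, ∃! p : Metric.sphere (0 : EuclideanSpace ℝ (Fin 3)) 1, (ν.sphere 0 p).2 = y₀) → Nonempty (M ≃ₘ⟮𝓡 4, 𝓡 4⟯ Metric.sphere (0 : EuclideanSpace ℝ (Fin 5)) 1) := by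
  sorry

/-- COMPOSITION (sorry-free; proof-of-item for C.StableMirrorCancellation #28014 BY NAME, W1 form). -/
theorem StableMirrorCancellation_of (hD : ThreeFibres.SurgeryDictionary) : Summit.SmoothPoincare4.SmoothPoincare4.Theses.RootDecompC.StableMirrorCancellation := by
  intro S _ hstab
  obtain ⟨e⟩ := S.nonempty_homotopyEquiv
  obtain ⟨ν, hemb, hcls, hsc, hsurg⟩ := hD S.carrier e hstab
  obtain ⟨ψ, x', hψ⟩ := stub_twinSeparation ν hemb hcls hsc
  obtain ⟨ν', hemb', hcls', hsc', hsurg', hoff'⟩ := stub_transport S.carrier e ν hemb hcls hsc hsurg ⟨ψ, x', hψ⟩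
  by_cases hd : (∃ y₀ : Metric.sphere (0 : EuclideanSpace ℝ (Fin 3)) 1, ∃! p : Metric.sphere (0 : EuclideanSpace ℝ (Fin 3)) 1, (ν'.sphere 0 p).2 = y₀)
  · exact stub_dualOnceOff S.carrier e ν' hemb' hcls' hsc' hsurg' hoff' hd
  · exact stub_nonDualKiller S.carrier e ν' hemb' hcls' hsc' hsurg' hoff' hd

/-- info: 'Summit.SmoothPoincare4.SmoothPoincare4.Cruxes.StableMirrorCancellation.KillerShape.StableMirrorCancellation_of' depends on axioms: [propext, sorryAx, Classical.choice, Quot.sound] -/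
#guard_msgs (whitespace := lax) in #print axioms StableMirrorCancellation_of

end Summit.SmoothPoincare4.SmoothPoincare4.Cruxes.StableMirrorCancellation.KillerShape
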